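import Mathlib
import HarnessLib
import HarnessLib.Audit
import Summits.ResolutionOfSingularities.Statement
import HarnessLib.Audit.Status.Attr

/-!
Route: HomologicalConductor

# Route HomologicalConductor — blow up the cohomology annihilator, normalise, repeat — the conductor
value along every valuation reaches zero; globalise by canonicity

BARRIER-INVERSION route (operator C). Assume the catalogue: no pointwise order invariant survives
(KangarooShadeIncrease, ResidualOrderUnbounded, NarasimhanMaximalContact,
DirectrixSmallCharacteristic); regularity cannot be transported along inseparable base change or
universal homeomorphisms (InseparableBaseChange, FrobeniusTwistResolution,
RegularNotGeometricallyRegular); no Puiseux parametrisation and no monomialisation of maps along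
valuations (ArtinSchreierPuiseux, LocalMonomializationFails); Zariski patching has no fourth step
(DimensionFourFrontier); and any argument valid for all noetherian F_p-algebras is false
(QuasiExcellenceNecessary: Nagata's ring). Then a successful line must (C1) measure progress by a
coordinate-free, cleaning-free datum, (C2) treat regularity absolutely over every field, (C3) avoid
parametrisations, (C4) consume finite generation over a field at a named step, (C5) globalise by
canonicity, not patching. It suffices to show X = Persistence ∧ StrictDrop ∧ NoZeno ∧ Globalisation
for the ONE canonical process these constraints leave: at a local ring A essentially of finite type
over a field k, blow up the Iyengar–Takahashi COHOMOLOGY ANNIHILATOR ca(A) = ⋃ₙ ⋂ ann Ext^(≥n)(mod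
A, mod A) (V(ca) = Sing A over EVERY field, IyengarTakahashi2014 Thm 5.4 / Kimura2024 Cor 2.6; ca =
conductor on curves, Esentepe2018; ca = 0 on Nagata's ring), normalise, localise at the centre of a
valuation v, repeat: T₀ = A_centre, T_(m+1) = (normalisation of T_m[ca(T_m)/x])_centre with v(x) =
min v(ca(T_m)). Persistence (homological Lipman–Sathaye): ca(T_m) ⊆ ca(T_(m+1)); StrictDrop: while
T_m is singular the minimal conductor value γ_m = min v(ca(T_m)) eventually drops; NoZeno (rank 2):
given both, γ reaches 0 — T_m regular — along EVERY valuation (automatic for discrete ones; the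
content is non-discrete rank-one = defect valuations); Globalisation: valuative termination over all
fields of char p ⇒ ResolutionInChar p (ca is a sheaf, the v-towers are local rings of ONE normalised
blow-up tower X_m → X, Reg X_m open by excellence, Riemann–Zariski quasi-compactness gives a uniform
m). Card realised: homological-conductor-ca-blowup (spine; its 'normalized ca-tower', made valuative
and typed). No Descent item is needed: every statement is over an arbitrary field of characteristic
p.
Lean: `Persistence ∧ StrictDrop ∧ NoZeno ∧ Globalisation`

## Assembly
Pure logic, certified sorry-free (sketch/Sketch.lean = glue.lean: lean check rc 0, axioms propext ·
Classical.choice · Quot.sound): NoZeno applied to Persistence and StrictDrop is valuative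
termination `∀ p prime, ∀ k K O A …, ∃ m, IsRegularLocalRing (tower A m)`, verbatim the antecedent
of Globalisation at p, which returns ResolutionInChar p; the summit is ∀ p prime, ResolutionInChar p
by `Iff.rfl`. `closes hP hD hT hG := fun p hp => hG p hp (hT hP hD p hp)` uses every crux; the two
supports are outside the deciding chain. The `let`-bound tower (ca, loc, chart, nrm, tower) is
textually identical in all six items, so the chain type-checks by ζ-reduction; the route file needs
only Mathlib (CategoryTheory.Abelian.Ext on ModuleCat, ValuationSubring, Subalgebra, IsIntegral,
IsRegularLocalRing) and the Statement.

Rationale: WHY THIS LINE. The barrier catalogue kills centres read off Taylor data and kills transport of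
regularity; the cohomology annihilator is the one canonical ideal on the ledger that is (i) defined
homologically — Ext does not differentiate, so it is not Frobenius-blind (Nobile's cusp z^p =
x^(p+1): Jacobian ideal (x^p) principal, so the Jacobian/Nash blow-up is the identity, while ca is
the conductor (Esentepe2018 Thm 5.12) and its blow-up is the normalisation) and needs no
coordinates, hypersurface of contact or cleaning; (ii) cut out exactly by the singular locus over
every field, perfect or not (IyengarTakahashi2014 Thm 5.4 uses separable Noether normalisations
after a finite base change — finite generation over a field is consumed HERE, and the equality V(ca)
= Sing fails for Nagata's ring, where ca = 0 and Krull's blow-up algorithm cannot start: Kollar2007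
Thm 1.101, IyengarTakahashi2014 Ex. 2.11); (iii) functorial enough to glue: a canonical ideal sheaf
makes the tower global, so Zariski's compactness of the Riemann–Zariski space replaces two-model
patching (Piltant2013, open in dim ≥ 4) — the inventor's paradox: the route proves MORE than local
uniformization locally (a FIXED sequence uniformizes) and is repaid by a free globalisation. The
termination measure is valuative and homological at once: γ_m = min v(ca(T_m)) in the value group,
monotone by Persistence — Esentepe2018 Thm 5.1 proves f(ca R) ⊆ ca S for maps with the weak
MCM-extending property, the template for the normalised ca-blow-up — so divisorial valuations
terminate for free and the whole difficulty is confined to non-discrete rank-one (defect)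
valuations, where Cutkosky–Mourtada locate the only obstruction to local uniformization
(CutkoskyMourtada2019), now carried by an intrinsic ideal instead of a residual order that a
coordinate change can pump (HauserPerlega2019). Imported area: homological commutative algebra of
singularity categories (annihilation of cohomology, MCM approximation, Noether different:
IyengarTakahashi2014, Esentepe2018, Kimura2024; one rung down, annihilators of LOCAL cohomology
drive Kawasaki–Česnavičius Macaulayfication, route FrobeniusLadder's solved rung — here the Ext-side
ideal aims at 'regular', not 'Cohen–Macaulay'). No listed route blows up a homological ideal,
follows a canonical tower, or uses a valuative Lyapunov quantity; the differential analogues (Nash /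
Jacobian / F-blow-up towers: Spivakovsky1990, CastilloEtAl2024, arXiv:2501.09811, Yasuda) are
exactly the Frobenius-blind instruments the catalogue warns against.

RANKED CRUXES. #2 NoZeno (crux) — given Persistence and StrictDrop, for every prime p, field k of
char p, finitely generated field K/k, valuation ring O ⊇ k of K and finitely generated A ⊆ O with
Frac A = K, the canonical normalised ca-tower T₀ = A_centre, T_(m+1) = (normalisation of
T_m[ca(T_m)/x])_centre reaches a REGULAR local ring at some finite m (the conductor value γ_m
reaches 0: no Zeno descent along non-discrete valuations; discrete valuations are automatic). [deps:
Persistence, StrictDrop] [difficulty: open-problem] (why it might fail: along a non-discrete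
rank-one (defect) valuation γ_m may decrease forever without reaching 0 — a homological shadow of
Hauser–Perlega's unbounded residual order; a self-similar tower (Hénon-type eigenvaluation, γ ↦ γ/p)
of normalised ca-blow-ups would refute it.) [HauserPerlega2019, CutkoskyMourtada2019,
IyengarTakahashi2014, arXiv:1802.05010]
#3 Persistence (crux) — homological Lipman–Sathaye: along the canonical tower the cohomology
annihilator only grows, ca(T_m) ⊆ ca(T_(m+1)) ⊆ K — an element killing all high Ext over T_m still
does so over the normalised ca-blow-up localised at the centre (Esentepe's weak MCM-extending
property for this map). [difficulty: L] (why it might fail: ca is not functorial along non-flat ring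
maps; Esentepe2018 Thm 5.1 needs the weak MCM-extending property (Gorenstein case), unknown for
normalised ca-blow-ups; one chart where an old annihilator stops killing Ext over the new ring
refutes it (computable on D_n, E_n, z^p+F surface points).) [Esentepe2018, LipmanSathaye1981,
IyengarTakahashi2014]
#4 StrictDrop (crux) — while T_m is singular the minimal conductor value eventually drops strictly:
some later T_(m') carries a nonzero y ∈ ca(T_(m')) with v(y) < v(x) for every nonzero x ∈ ca(T_m)
(no loop at constant value; implied by termination, it isolates 'the tower does not idle').
[difficulty: L] (why it might fail: the tower may loop at CONSTANT minimal value (ca growing only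
sideways), as the normalised Nash tower loops on a toric fourfold in every characteristic
(CastilloEtAl2024); ca of that cone and its normalised blow-up are uncomputed.) [CastilloEtAl2024,
arXiv:2501.09811, Spivakovsky1990, Lipman1978]
#5 Globalisation (crux) — for every prime p: valuative termination of the canonical ca-tower over
all fields of char p (NoZeno's conclusion, verbatim) ⇒ ResolutionInChar p. Content: ca is a
quasi-coherent ideal SHEAF (ca(R_f) = ca(R)·R_f for reduced affine k-algebras), so the v-towers are
the local rings at the centres of v on ONE normalised blow-up tower X_m → X (proper, birational, iso
over Reg X_(m−1)); Reg X_m open (excellence) and Riemann–Zariski quasi-compactness give one m with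
X_m regular; reduced ⇒ integral components; V(ca) = Sing (IyengarTakahashi2014 Thm 5.4) identifies
the end. [difficulty: M] (why it might fail: needs ca to be a sheaf: IyengarTakahashi2014 Lemma 2.10
proves only U⁻¹ca(R) ⊆ ca(U⁻¹R) and Kimura2024 only radical-level equalities; if localisation
enlarges ca, the valuation-wise towers are not charts of one global tower and compactness has
nothing to act on.) [IyengarTakahashi2014, Kimura2024, ZariskiSamuel1960, Piltant2013]
#9 CurveStep (support) — calibration in dimension one, provable now: for A of Krull dimension 1 the
first step T₁ is already regular (normalisation of a one-dimensional noetherian domain is Dedekind,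
Krull–Akizuki; for Gorenstein curves ca = conductor and Bl_ca = normalisation, Esentepe2018 Thm
4.4/5.12, Kollar2007 Thm 1.101) — exercises the tower encoding. [difficulty: provable-now]
[Esentepe2018, Kollar2007, IyengarTakahashi2014]
#9 SurfaceTermination (support) — dominated special case (the card's K1, first real test): for A of
Krull dimension 2 the canonical tower terminates along every valuation — normalised blow-ups of the
m-primary ideal ca of a normal surface singularity in place of Zariski–Lipman's maximal ideal;
checked by hand on A_n (ca = (x,y,z^⌈n/2⌉) bisects the chain), D_4, D_5 (card computations), open at
non-rational and wild rational double points. [difficulty: L] [Lipman1978, Spivakovsky1990,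
IyengarTakahashi2014, Esentepe2018]

TWO-LAYER PLAN. Foreseen glued splits (not filed now): NoZeno ⇐ RankOneNonDiscrete (γ reaches 0
along rank-one non-discrete valuations) → RankReduction (composite valuations: termination at the
rank-one coarsening plus termination of the induced tower on the residue side) → NoZeno;
Globalisation ⇐ CaSheaf (ca(R_f) = ca(R)R_f, pure commutative algebra) → TowerCompactness (global
normalised blow-up tower + RZ quasi-compactness ⇒ HasResolution) → Globalisation; Persistence ⇐
McmExtending (the normalised ca-blow-up has Esentepe's weak MCM-extending property) → Persistence (k
≤ 3, depth 1).

KILL CRITERIA. A computed normalised ca-blow-up at which an old annihilator fails to annihilate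
(¬Persistence) breaks the monotone mechanism: repair only by changing the ideal (ca^(d+1),
Jacobian·ca, Noether/Kähler different) as a NEW item, else close refuted:Persistence. A loop at
constant conductor value (¬StrictDrop, e.g. on CastilloEtAl2024's toric fourfold) or a Zeno tower
(¬NoZeno) closes the route refuted — and is worth having: the first FORCED periodic blow-up tower in
the subject (negative knowledge for FrobeniusClosing / ShadowGame). ¬Globalisation can only come
from non-sheafiness of ca: pivot to the sheafified ideal ⋂_𝔭 ca(R_𝔭) (restate Globalisation, keep
the local cruxes). Local uniformization + patching proved elsewhere (Valuative / IndSmooth) does NOT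
moot this route (different, canonical object); the summit proved by any route moots it.

NOT DECOMPOSED YET. Rank reduction for composite valuations; the sheaf property of ca (inside
Globalisation); the wild core T = S[z]/(z^p+F) (ca ∩ S ⊇ (∂F/∂x_i) is cleaning-invariant — the
card's K3) as a dominated special case of NoZeno; the surface case beyond ADE (support
SurfaceTermination); imperfect-residue-field points need nothing extra (IyengarTakahashi2014 Thm 5.4
is over any field) and are deliberately not split off.

CHEAPEST FALSIFIER. (a) Macaulay2-sized, NOT run (no M2 on kit; logged for the refuter): ca and ONE
normalised ca-blow-up of CastilloEtAl2024's toric fourfold cone (a chart isomorphic to the cone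
kills StrictDrop or NoZeno) and of the E_6, E_7, E_8 and wild D_4^0, E_8^0 (char 2) surface points
(does λ = ℓ(T/ca) drop at every singular point upstairs? card data: ca(E_8) = (x, yz, z³, y²),
ca(A_n) = (x, y, z^⌈n/2⌉) with Bl_ca bisecting the A_n chain, D_4 → one A_1, D_5 → three A_1 —
consistent). (b) In-Lean/elementary, DONE by hand: regular A ⇒ ca = A ⇒ chart = A ⇒ tower stationary
(no junk progress); singular normal A ⇒ ht ca ≥ 2 ⇒ ca never principal ⇒ no trivial stall; dimension
one ⇒ T₁ regular (CurveStep). (c) Literature lookup, DONE: no paper blows up ca (arXiv 'cohomology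
annihilator', 20 hits, 2014–2025); persistence template = Esentepe2018 Thm 5.1; Sing = V(ca) over
any field = IyengarTakahashi2014 Thm 5.4 / Kimura2024 Cor 2.6.

NUMBERS. Stability index: V(ca(R)) = V(ca^(d+1)(R)), d = dim R, for R local or with a dualizing
complex (Kimura2024 Thm 1.1); IyengarTakahashi2014 Thm 5.4 uses 2d+1 (d+1 for domains over perfect
fields, Wang). Curves: ca = conductor for one-dimensional Gorenstein local rings with reduced
completion (Esentepe2018 Thm 5.12); Nagata's ring: ca = 0 (card P1). ADE (card, all characteristics
where tame): ca(A_n) = (x, y, z^⌈n/2⌉), tower length ⌊log₂(n+1)⌋; ca(E_8) = (x, yz, z³, y²) (Coxeter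
truncation R_(≥h−1)). Normalised Nash towers loop in every dimension ≥ 4 and every characteristic
(CastilloEtAl2024). Items at open: 7 (4 cruxes, 2 supports, 1 assembly).

DEFINITION REQUESTS. After open: `ledger workitem add --kind definition --notion
CohomologyAnnihilator --topic Literature/RingTheory/CohomologyAnnihilator` (IyengarTakahashi2014 §2:
caₙ(R) = ⋂_(M,N) ann Ext^(≥n), ca = ⋃ caₙ, Lemma 2.10 (localisation ⊆), Thm 5.4 (V(ca) = Sing for
localisations of affine algebras over any field) as a named fact; Esentepe2018 Thm 5.1/5.12) — the
route file inlines ca as a `let` over Mathlib's `CategoryTheory.Abelian.Ext` on `ModuleCat`, so no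
definition blocks the open; the Literature notion lets provers replace the inline set by the named
ideal. Cite fact wanted: IyengarTakahashi2014 Thm 5.4 ('fact: Sing R = V(ca R) for R essentially of
finite type over a field').

Novelty: Searches (2026-08-16): `lit search --source arxiv "cohomology annihilator"` (20 hits:
IyengarTakahashi2014, Esentepe2018, Kimura2024, Dey–Liu–Mifune–Otake arXiv:2503.24186, Esentepe
arXiv:2510.05720, Cuong–Cuong arXiv:1305.5609 (LOCAL-cohomology annihilators → Macaulayfication),
Bahlekeh et al. arXiv:1504.06163; none birational); `lit search --source arxiv "Nash blowup positive
characteristic"` (4: arXiv:2409.04688, arXiv:2501.09811, arXiv:2002.07081, arXiv:2412.07254); `lit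
search --source arxiv "cohomology annihilator blow-up resolution of singularities"` (0); `lit galaxy
search "cohomology annihilator" --star all` (0) and `"annihilation of cohomology" --star all` (2:
Benson's textbook, Bhatt arXiv:2008.08070 — unrelated); `lit frontier ResolutionOfSingularities
--since 2023` (30 rows; canonical blow-ups only via ranking functions arXiv:2602.06553 and weighted
centres; nothing homological); `lit read arXiv:1404.1476` (Lemma 2.10, Thms 5.3–5.4 read), `lit read
arXiv:1807.05471` (Thms 4.3–4.4, 5.1, 5.12 read), `lit read arXiv:2409.17934` (Thm 1.1, Cor 2.6
read); ledger: 19 route headers, 184 cards (spine card homological-conductor-ca-blowup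
open/unrouted, grade new-combination), `ledger negatives` (0). OpenAlex/S2 rate-limited and local
searchd reset all session (stated limitation).
Nearest prior art found: IyengarTakahashi2014 (arXiv:1404.1476: the ideal, V(ca) = Sing; never blown
up); Esentepe2018 (arXiv:1807.05471: ca = conductor on curves, persistence under MCM-extending  [refs: 2503.24186, 2510.05720, 1305.5609, 1504.06163, 2409.04688, 2501.09811, 2002.07081, 2412.07254, 2008.08070, 2602.06553, 1404.1476, 1807.05471, 2409.17934, 1810.04493, IyengarTakahashi2014, Esentepe2018, Kimura2024, Spivakovsky1990, CastilloEtAl2024]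

Barriers (technique_class: homological-annihilator-blowup, valuative-lyapunov): - technique_class: homological-annihilator-blowup, valuative-lyapunov
- Literature.Barriers.ResolutionOfSingularities.quasiExcellence_barrier: consumed, not evaded —
V(ca) = Sing is a theorem for algebras essentially of finite type over a field (IyengarTakahashi2014
Thm 5.4) and FALSE for Nagata's ring (ca = 0, Krull's criterion fails: Kollar2007 Thm 1.101 /
Nagata1962_nonFiniteNormalization), so the line provably cannot prove the false generality
(constraint C4).
- Literature.Barriers.ResolutionOfSingularities.Hauser2003_kangarooShadeIncrease: evaded by object —
no order, residual order, shade or coefficient ideal is tracked; the measure γ_m = min v(ca(T_m)) is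
defined without coordinates, hypersurfaces or cleaning, so the coordinate change x ↦ x + yz³ that
creates the kangaroo does not act on it (C1).
- Literature.Barriers.ResolutionOfSingularities.hauserPerlega_mohProofBoundFails: not evaded in
substance — an unbounded residual order could reappear as a Zeno descent of γ along a defect
valuation; the bet (crux NoZeno) is that Persistence makes γ monotone in the value group, which no
residual-order invariant is, and that HP's runs (unforced point centres) are not runs of the
canonical tower (its centres are V(ca), whole non-reduced singular strata).
- Literature.Barriers.ResolutionOfSingularities.Narasimhan1983_noSmoothHypersurfaceThroughTopLocus:
evaded — the centre is the subscheme V(ca) ⊇ the top locus itself (singular, non-reduced allowed),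
never a smooth hypersurface c

History (route lifecycle, newest last):
- 2026-08-25T09:51:14Z · DORMANT — reconciler: no traction for 7.6 d (last activity item-evidence-added at 2026-08-17T19:09:50Z); parked, not closed — `ledger route dormant route-ResolutionOfSing (operator:999:2019405)
- 2026-08-26T14:56:13Z · REACTIVATED — director-resolution L0 tranche seated (D-0089 rescue); operator clears dormancy (operator:999:3579025)
- 2026-08-26T15:40:35Z · DORMANT — reconciler: no traction for 8.8 d (last activity item-evidence-added at 2026-08-17T19:09:50Z); parked, not closed — `ledger route dormant route-ResolutionOfSing (operator:999:2439767)
- 2026-08-26T16:25:33Z · REACTIVATED — dormant cleared (operator:999:1072286)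
- 2026-08-27T16:14:17Z · BROKEN — Persistence (stmt-ResolutionOfSingularities-16484, aside) refuted by Summit.ResolutionOfSingularities.ResolutionOfSingularities.Theorems.not_Persistence (prover-res-L1-w44b-lead-1-g2-0)
- 2026-08-27T16:15:41Z · rev 6: restated Assembly (stmt-ResolutionOfSingularities-16489) — repair after not_Persistence (p546734, refuted-misstated; repaired = PersistenceRadical p471149): drop the aside item Persistence (not a binder of closes) and r (planner-res-L1-w44b-plan-1-g14-0)
- 2026-08-27T16:15:41Z · rev 6: dropped Persistence — repair after not_Persistence (p546734, refuted-misstated; repaired = PersistenceRadical p471149): drop the aside item Persistence (not a binder of closes) and r (planner-res-L1-w44b-plan-1-g14-0)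
- 2026-08-27T16:15:41Z · REPAIRED (restate Assembly; drop Persistence) — back to open: repair after not_Persistence (p546734, refuted-misstated; repaired = PersistenceRadical p471149): drop the aside item Persistence (not a binder of closes) and r (planner-res-L1-w44b-plan-1-g14-0)

sub-problem: ResolutionOfSingularities · status: open · opened planner-plan-novel-ResolutionOfSingularities-Re-dc19aa3a-c-v2-g5-0 2026-08-16T19:15:26Z · rev 6 · ledger route-ResolutionOfSingularities-HomologicalConductor
GENERATED by the gate from the ledger (D-0016/17). Provers cite these decls: `theorem foo : Summit.ResolutionOfSingularities.ResolutionOfSingularities.Theses.HomologicalConductor.<Decl> := …` in Summits/ResolutionOfSingularities/ResolutionOfSingularities/Theorems/<Name>.lean.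
-/

namespace Summit.ResolutionOfSingularities.ResolutionOfSingularities.Theses.HomologicalConductor

open scoped BigOperators Topology Manifold Classical MeasureTheory ProbabilityTheory Matrix InnerProductSpace ComplexConjugate ContinuousMap
open Filter Set Function TopologicalSpace MeasureTheory

attribute [summit_statement] _root_.ResolutionOfSingularities

/-! Retired items kept as plain definitions (history; not obligations of this route): landed proofs / closed glue still name them. -/

/-- retired stmt-ResolutionOfSingularities-16484 (dropped, gen None) — refuted by Summit.ResolutionOfSingularities.ResolutionOfSingularities.Theorems.not_Persistence. -/
def Persistence : Prop :=
  ∀ p : ℕ, p.Prime → ∀ (k K : Type) [Field k] [CharP k p] [Field K] [Algebra k K] (O : ValuationSubring K) (A : Subalgebra k K), (∀ c : k, algebraMap k K c ∈ O) → A.FG → IsFractionRing ↥A K → A.toSubring ≤ O.toSubring → let ca : Subalgebra k K → Set K := fun A => {x : K | ∃ hx : x ∈ A, ∃ n : ℕ, ∀ i : ℕ, n ≤ i → ∀ (M N : ModuleCat.{0} ↥A), Module.Finite ↥A M → Module.Finite ↥A N → ∀ e : CategoryTheory.Abelian.Ext.{0} M N i, (⟨x, hx⟩ : ↥A) • e =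 0}; let loc : Subalgebra k K → Subalgebra k K := fun A => Algebra.adjoin k {y : K | ∃ a ∈ A, ∃ s ∈ A, s⁻¹ ∈ O ∧ y = a * s⁻¹}; let chart : Subalgebra k K → Subalgebra k K := fun A => Algebra.adjoin k ((A : Set K) ∪ {y : K | ∃ c ∈ ca A, ∃ x ∈ ca A, x ≠ 0 ∧ (∀ c' ∈ ca A, c' * x⁻¹ ∈ O) ∧ y = c * x⁻¹}); let nrm : Subalgebra k K → Subalgebra k K := fun B => Algebra.adjoin k {y : K | IsIntegral ↥B y}; let tower : Subalgebra k K → ℕ → Subalgebra k K := fun A m => @Nat.rec (fun _ => Subalgebra k K) (loc A) (fun _ B => loc (nrm (chart B))) m; ∀ m : ℕ, ca (tower A m) ⊆ ca (tower A (m + 1))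

/-- item stmt-ResolutionOfSingularities-19943 · crux · rank 2 · open · by operator
[crux] NoZeno with its Persistence hypothesis weakened to PersistenceRadical (stmt-19920);
noZeno_of_noZenoR certified; W4.4 skeleton NoZeno_of re-types verbatim (res-L0-w44-plan-1 CRUX-PLAN
§6); caveat: only γ_(m+1) ≤ N·γ_m survives -/
@[route_item "route-ResolutionOfSingularities-HomologicalConductor", crux (bottleneck := work) (source := "director HOURLY-RESOLUTION l.1136, 2026-09-01")]
def NoZenoR : Prop :=
  (∀ p : ℕ, p.Prime → ∀ (k K : Type) [Field k] [CharP k p] [Field K] [Algebra k K] (O : ValuationSubring K) (A : Subalgebra k K), (∀ c : k, algebraMap k K c ∈ O) → A.FG → IsFractionRing ↥A K → A.toSubring ≤ O.toSubring → let ca : Subalgebra k K → Set K := fun A => {x : K | ∃ hx : x ∈ A, ∃ n : ℕ, ∀ i : ℕ, n ≤ i → ∀ (M N : ModuleCat.{0} ↥A), Module.Finite ↥A M → Module.Finite ↥A N → ∀ e : CategoryTheory.Abelian.Ext.{0} M N i, (⟨x, hx⟩ : ↥A) • e = 0}; let loc : Subalgebra k K → Subalgebra k K := fun A => Algebra.adjoin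 k {y : K | ∃ a ∈ A, ∃ s ∈ A, s⁻¹ ∈ O ∧ y = a * s⁻¹}; let chart : Subalgebra k K → Subalgebra k K := fun A => Algebra.adjoin k ((A : Set K) ∪ {y : K | ∃ c ∈ ca A, ∃ x ∈ ca A, x ≠ 0 ∧ (∀ c' ∈ ca A, c' * x⁻¹ ∈ O) ∧ y = c * x⁻¹}); let nrm : Subalgebra k K → Subalgebra k K := fun B => Algebra.adjoin k {y : K | IsIntegral ↥B y}; let tower : Subalgebra k K → ℕ → Subalgebra k K := fun A m => @Nat.rec (fun _ => Subalgebra k K) (loc A) (fun _ B => loc (nrm (chart B))) m; ∀ m : ℕ, ∀ x ∈ ca (tower A m), ∃ N : ℕ, 1 ≤ N ∧ x ^ N ∈ ca (tower A (m + 1))) → (∀ p : ℕ, p.Prime → ∀ (k K : Type) [Field k] [CharP k p] [Field K] [Algebra k K] (O : ValuationSubring K) (A : Subalgebra k K), (∀ c : k, algebraMap k K c ∈ O) → A.FG → IsFractionRing ↥A K → A.toSubring ≤ O.toSubring → let ca : Subalgebra k K → Set K := fun A => {x : K | ∃ hx : x ∈ A, ∃ n : ℕ, ∀ i : ℕ,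 n ≤ i → ∀ (M N : ModuleCat.{0} ↥A), Module.Finite ↥A M → Module.Finite ↥A N → ∀ e : CategoryTheory.Abelian.Ext.{0} M N i, (⟨x, hx⟩ : ↥A) • e = 0}; let loc : Subalgebra k K → Subalgebra k K := fun A => Algebra.adjoin k {y : K | ∃ a ∈ A, ∃ s ∈ A, s⁻¹ ∈ O ∧ y = a * s⁻¹}; let chart : Subalgebra k K → Subalgebra k K := fun A => Algebra.adjoin k ((A : Set K) ∪ {y : K | ∃ c ∈ ca A, ∃ x ∈ ca A, x ≠ 0 ∧ (∀ c' ∈ ca A, c' * x⁻¹ ∈ O) ∧ y = c * x⁻¹}); let nrm : Subalgebra k K → Subalgebra k K := fun B => Algebra.adjoin k {y : K | IsIntegral ↥B y}; let tower : Subalgebra k K → ℕ → Subalgebra k K := fun A m => @Nat.rec (fun _ => Subalgebra k K) (loc A) (fun _ B => loc (nrm (chart B))) m; ∀ m : ℕ, ¬ IsRegularLocalRing ↥(tower A m) → ∃ m' : ℕ, m < m' ∧ ∃ y ∈ ca (tower A m'), y ≠ 0 ∧ ∀ x ∈ ca (tower A m), x ≠ 0 → y * x⁻¹ ∉ O) →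 ∀ p : ℕ, p.Prime → ∀ (k K : Type) [Field k] [CharP k p] [Field K] [Algebra k K] (O : ValuationSubring K) (A : Subalgebra k K), (∀ c : k, algebraMap k K c ∈ O) → A.FG → IsFractionRing ↥A K → A.toSubring ≤ O.toSubring → let ca : Subalgebra k K → Set K := fun A => {x : K | ∃ hx : x ∈ A, ∃ n : ℕ, ∀ i : ℕ, n ≤ i → ∀ (M N : ModuleCat.{0} ↥A), Module.Finite ↥A M → Module.Finite ↥A N → ∀ e : CategoryTheory.Abelian.Ext.{0} M N i, (⟨x, hx⟩ : ↥A) • e = 0}; let loc : Subalgebra k K → Subalgebra k K := fun A => Algebra.adjoin k {y : K | ∃ a ∈ A, ∃ s ∈ A, s⁻¹ ∈ O ∧ y = a * s⁻¹}; let chart : Subalgebra k K → Subalgebra k K := fun A => Algebra.adjoin k ((A : Set K) ∪ {y : K | ∃ c ∈ ca A, ∃ x ∈ ca A, x ≠ 0 ∧ (∀ c' ∈ ca A, c' * x⁻¹ ∈ O) ∧ y = c * x⁻¹}); let nrm : Subalgebra k K → Subalgebra k K := fun B => Algebra.adjoin k {y : K | IsIntegral ↥B y}; let tower : Subalgebra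 k K → ℕ → Subalgebra k K := fun A m => @Nat.rec (fun _ => Subalgebra k K) (loc A) (fun _ B => loc (nrm (chart B))) m; ∃ m : ℕ, IsRegularLocalRing ↥(tower A m)

/-- item stmt-ResolutionOfSingularities-16485 · crux · rank 4 · open · by planner
why it might fail: the tower may loop at CONSTANT minimal value (ca growing only sideways), as the normalised Nash tower loops on a toric fourfold in every characteristic (CastilloEtAl2024); ca of that cone and its normalised blow-up are uncomputed.
sources: CastilloEtAl2024, arXiv:2501.09811, Spivakovsky1990, Lipman1978
[crux] while T_m is singular the minimal conductor value eventually drops strictly: some later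
T_(m') carries a nonzero y ∈ ca(T_(m')) with v(y) < v(x) for every nonzero x ∈ ca(T_m) (no loop at
constant value; implied by termination, it isolates 'the tower does not idle'). [difficulty: L] -/
@[route_item "route-ResolutionOfSingularities-HomologicalConductor", crux]
def StrictDrop : Prop :=
  ∀ p : ℕ, p.Prime → ∀ (k K : Type) [Field k] [CharP k p] [Field K] [Algebra k K] (O : ValuationSubring K) (A : Subalgebra k K), (∀ c : k, algebraMap k K c ∈ O) → A.FG → IsFractionRing ↥A K → A.toSubring ≤ O.toSubring → let ca : Subalgebra k K → Set K := fun A => {x : K | ∃ hx : x ∈ A, ∃ n : ℕ, ∀ i : ℕ, n ≤ i → ∀ (M N : ModuleCat.{0} ↥A), Module.Finite ↥A M → Module.Finite ↥A N → ∀ e : CategoryTheory.Abelian.Ext.{0} M N i, (⟨x, hx⟩ : ↥A) • e = 0}; let loc : Subalgebra k K → Subalgebra k K := fun A => Algebra.adjoin k {y : K | ∃ a ∈ A, ∃ s ∈ A, s⁻¹ ∈ O ∧ y = a * s⁻¹}; let chart : Subalgebra k K → Subalgebra k K := fun A => Algebra.adjoin k ((A : Set K) ∪ {y : K | ∃ c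 ∈ ca A, ∃ x ∈ ca A, x ≠ 0 ∧ (∀ c' ∈ ca A, c' * x⁻¹ ∈ O) ∧ y = c * x⁻¹}); let nrm : Subalgebra k K → Subalgebra k K := fun B => Algebra.adjoin k {y : K | IsIntegral ↥B y}; let tower : Subalgebra k K → ℕ → Subalgebra k K := fun A m => @Nat.rec (fun _ => Subalgebra k K) (loc A) (fun _ B => loc (nrm (chart B))) m; ∀ m : ℕ, ¬ IsRegularLocalRing ↥(tower A m) → ∃ m' : ℕ, m < m' ∧ ∃ y ∈ ca (tower A m'), y ≠ 0 ∧ ∀ x ∈ ca (tower A m), x ≠ 0 → y * x⁻¹ ∉ O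

/-- item stmt-ResolutionOfSingularities-16486 · crux · rank 5 · open · by planner
why it might fail: needs ca to be a sheaf: IyengarTakahashi2014 Lemma 2.10 proves only U⁻¹ca(R) ⊆ ca(U⁻¹R) and Kimura2024 only radical-level equalities; if localisation enlarges ca, the valuation-wise towers are not charts of one global tower and compactness has nothing to act on.
sources: IyengarTakahashi2014, Kimura2024, ZariskiSamuel1960, Piltant2013
[crux] for every prime p: valuative termination of the canonical ca-tower over all fields of char p
(NoZeno's conclusion, verbatim) ⇒ ResolutionInChar p. Content: ca is a quasi-coherent ideal SHEAF
(ca(R_f) = ca(R)·R_f for reduced affine k-algebras), so the v-towers are the local rings at the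
centres of v on ONE normalised blow-up tower X_m → X (proper, birational, iso over Reg X_(m−1)); Reg
X_m open (excellence) and Riemann–Zariski quasi-compactness give one m with X_m regular; reduced ⇒
integral components; V(ca) = Sing (IyengarTakahashi2014 Thm 5.4) identifies the end. [difficulty: M] -/
@[route_item "route-ResolutionOfSingularities-HomologicalConductor", crux]
def Globalisation : Prop :=
  ∀ p : ℕ, p.Prime → (∀ (k K : Type) [Field k] [CharP k p] [Field K] [Algebra k K] (O : ValuationSubring K) (A : Subalgebra k K), (∀ c : k, algebraMap k K c ∈ O) → A.FG → IsFractionRing ↥A K → A.toSubring ≤ O.toSubring → let ca : Subalgebra k K → Set K := fun A => {x : K | ∃ hx : x ∈ A, ∃ n : ℕ, ∀ i : ℕ, n ≤ i → ∀ (M N : ModuleCat.{0} ↥A), Module.Finite ↥A M → Module.Finite ↥A N → ∀ e : CategoryTheory.Abelian.Ext.{0} M N i, (⟨x, hx⟩ : ↥A) • e = 0}; let loc : Subalgebra k K → Subalgebra k K := fun A => Algebra.adjoin k {y : K | ∃ a ∈ A, ∃ s ∈ A, s⁻¹ ∈ O ∧ y = a * s⁻¹}; let chart : Subalgebra k K →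 Subalgebra k K := fun A => Algebra.adjoin k ((A : Set K) ∪ {y : K | ∃ c ∈ ca A, ∃ x ∈ ca A, x ≠ 0 ∧ (∀ c' ∈ ca A, c' * x⁻¹ ∈ O) ∧ y = c * x⁻¹}); let nrm : Subalgebra k K → Subalgebra k K := fun B => Algebra.adjoin k {y : K | IsIntegral ↥B y}; let tower : Subalgebra k K → ℕ → Subalgebra k K := fun A m => @Nat.rec (fun _ => Subalgebra k K) (loc A) (fun _ B => loc (nrm (chart B))) m; ∃ m : ℕ, IsRegularLocalRing ↥(tower A m)) → Literature.AlgebraicGeometry.Resolution.ResolutionInChar.{0} p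

/-- item stmt-ResolutionOfSingularities-16483 · aside · rank 2 · open · by planner
why it might fail: along a non-discrete rank-one (defect) valuation γ_m may decrease forever without reaching 0 — a homological shadow of Hauser–Perlega's unbounded residual order; a self-similar tower (Hénon-type eigenvaluation, γ ↦ γ/p) of normalised ca-blow-ups would refute it.
sources: HauserPerlega2019, CutkoskyMourtada2019, IyengarTakahashi2014, arXiv:1802.05010
[crux] given Persistence and StrictDrop, for every prime p, field k of char p, finitely generated
field K/k, valuation ring O ⊇ k of K and finitely generated A ⊆ O with Frac A = K, the canonical
normalised ca-tower T₀ = A_centre, T_(m+1) = (normalisation of T_m[ca(T_m)/x])_centre reaches a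
REGULAR local ring at some finite m (the conductor value γ_m reaches 0: no Zeno descent along
non-discrete valuations; discrete valuations are automatic). [deps: Persistence, StrictDrop]
[difficulty: open-problem] -/
@[route_item "route-ResolutionOfSingularities-HomologicalConductor", crux]
def NoZeno : Prop :=
  (∀ p : ℕ, p.Prime → ∀ (k K : Type) [Field k] [CharP k p] [Field K] [Algebra k K] (O : ValuationSubring K) (A : Subalgebra k K), (∀ c : k, algebraMap k K c ∈ O) → A.FG → IsFractionRing ↥A K → A.toSubring ≤ O.toSubring → let ca : Subalgebra k K → Set K := fun A => {x : K | ∃ hx : x ∈ A, ∃ n : ℕ, ∀ i : ℕ, n ≤ i → ∀ (M N : ModuleCat.{0} ↥A), Module.Finite ↥A M → Module.Finite ↥A N → ∀ e : CategoryTheory.Abelian.Ext.{0} M N i, (⟨x, hx⟩ : ↥A) • e = 0}; let loc : Subalgebra k K → Subalgebra k K := fun A => Algebra.adjoin k {y : K | ∃ a ∈ A, ∃ s ∈ A, s⁻¹ ∈ O ∧ y = a * s⁻¹}; let chart : Subalgebra k K → Subalgebra k K := fun A => Algebra.adjoin k ((A : Set K) ∪ {y : K | ∃ c ∈ ca A,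 ∃ x ∈ ca A, x ≠ 0 ∧ (∀ c' ∈ ca A, c' * x⁻¹ ∈ O) ∧ y = c * x⁻¹}); let nrm : Subalgebra k K → Subalgebra k K := fun B => Algebra.adjoin k {y : K | IsIntegral ↥B y}; let tower : Subalgebra k K → ℕ → Subalgebra k K := fun A m => @Nat.rec (fun _ => Subalgebra k K) (loc A) (fun _ B => loc (nrm (chart B))) m; ∀ m : ℕ, ca (tower A m) ⊆ ca (tower A (m + 1))) → (∀ p : ℕ, p.Prime → ∀ (k K : Type) [Field k] [CharP k p] [Field K] [Algebra k K] (O : ValuationSubring K) (A : Subalgebra k K), (∀ c : k, algebraMap k K c ∈ O) → A.FG → IsFractionRing ↥A K → A.toSubring ≤ O.toSubring → let ca : Subalgebra k K → Set K := fun A => {x : K | ∃ hx : x ∈ A, ∃ n : ℕ, ∀ i : ℕ, n ≤ i → ∀ (M N : ModuleCat.{0} ↥A), Module.Finite ↥A M → Module.Finite ↥A N → ∀ e : CategoryTheory.Abelian.Ext.{0} M N i, (⟨x, hx⟩ : ↥A) • e = 0}; let loc : Subalgebra k K → Subalgebra k K := fun A => Algebra.adjoin k {y : K | ∃ a ∈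 A, ∃ s ∈ A, s⁻¹ ∈ O ∧ y = a * s⁻¹}; let chart : Subalgebra k K → Subalgebra k K := fun A => Algebra.adjoin k ((A : Set K) ∪ {y : K | ∃ c ∈ ca A, ∃ x ∈ ca A, x ≠ 0 ∧ (∀ c' ∈ ca A, c' * x⁻¹ ∈ O) ∧ y = c * x⁻¹}); let nrm : Subalgebra k K → Subalgebra k K := fun B => Algebra.adjoin k {y : K | IsIntegral ↥B y}; let tower : Subalgebra k K → ℕ → Subalgebra k K := fun A m => @Nat.rec (fun _ => Subalgebra k K) (loc A) (fun _ B => loc (nrm (chart B))) m; ∀ m : ℕ, ¬ IsRegularLocalRing ↥(tower A m) → ∃ m' : ℕ, m < m' ∧ ∃ y ∈ ca (tower A m'), y ≠ 0 ∧ ∀ x ∈ ca (tower A m), x ≠ 0 → y * x⁻¹ ∉ O) → ∀ p : ℕ, p.Prime → ∀ (k K : Type) [Field k] [CharP k p] [Field K] [Algebra k K] (O : ValuationSubring K) (A : Subalgebra k K), (∀ c : k, algebraMap k K c ∈ O) → A.FG → IsFractionRing ↥A K → A.toSubring ≤ O.toSubring → let ca : Subalgebra k K → Set K := fun A => {x :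 K | ∃ hx : x ∈ A, ∃ n : ℕ, ∀ i : ℕ, n ≤ i → ∀ (M N : ModuleCat.{0} ↥A), Module.Finite ↥A M → Module.Finite ↥A N → ∀ e : CategoryTheory.Abelian.Ext.{0} M N i, (⟨x, hx⟩ : ↥A) • e = 0}; let loc : Subalgebra k K → Subalgebra k K := fun A => Algebra.adjoin k {y : K | ∃ a ∈ A, ∃ s ∈ A, s⁻¹ ∈ O ∧ y = a * s⁻¹}; let chart : Subalgebra k K → Subalgebra k K := fun A => Algebra.adjoin k ((A : Set K) ∪ {y : K | ∃ c ∈ ca A, ∃ x ∈ ca A, x ≠ 0 ∧ (∀ c' ∈ ca A, c' * x⁻¹ ∈ O) ∧ y = c * x⁻¹}); let nrm : Subalgebra k K → Subalgebra k K := fun B => Algebra.adjoin k {y : K | IsIntegral ↥B y}; let tower : Subalgebra k K → ℕ → Subalgebra k K := fun A m => @Nat.rec (fun _ => Subalgebra k K) (loc A) (fun _ B => loc (nrm (chart B))) m; ∃ m : ℕ, IsRegularLocalRing ↥(tower A m)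

/-- item stmt-ResolutionOfSingularities-16487 · support · rank 9 · closed · proved by Summit.ResolutionOfSingularities.ResolutionOfSingularities.Theorems.curveStep_proof (prover) · by planner
sources: Esentepe2018, Kollar2007, IyengarTakahashi2014
[support] calibration in dimension one, provable now: for A of Krull dimension 1 the first step T₁
is already regular (normalisation of a one-dimensional noetherian domain is Dedekind, Krull–Akizuki;
for Gorenstein curves ca = conductor and Bl_ca = normalisation, Esentepe2018 Thm 4.4/5.12,
Kollar2007 Thm 1.101) — exercises the tower encoding. [difficulty: provable-now] -/
@[route_item "route-ResolutionOfSingularities-HomologicalConductor"]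
def CurveStep : Prop :=
  ∀ p : ℕ, p.Prime → ∀ (k K : Type) [Field k] [CharP k p] [Field K] [Algebra k K] (O : ValuationSubring K) (A : Subalgebra k K), (∀ c : k, algebraMap k K c ∈ O) → A.FG → IsFractionRing ↥A K → A.toSubring ≤ O.toSubring → ringKrullDim ↥A = 1 → let ca : Subalgebra k K → Set K := fun A => {x : K | ∃ hx : x ∈ A, ∃ n : ℕ, ∀ i : ℕ, n ≤ i → ∀ (M N : ModuleCat.{0} ↥A), Module.Finite ↥A M → Module.Finite ↥A N → ∀ e : CategoryTheory.Abelian.Ext.{0} M N i, (⟨x, hx⟩ : ↥A) • e = 0}; let loc : Subalgebra k K → Subalgebra k K := fun A => Algebra.adjoin k {y : K | ∃ a ∈ A, ∃ s ∈ A, s⁻¹ ∈ O ∧ y = a * s⁻¹}; let chart : Subalgebra k K → Subalgebra k K := fun A => Algebra.adjoin k ((A : Set K) ∪ {y : K | ∃ c ∈ ca A, ∃ x ∈ ca A, x ≠ 0 ∧ (∀ c' ∈ ca A, c' * x⁻¹ ∈ O) ∧ y = c * x⁻¹}); let nrm : Subalgebra k K → Subalgebra k K := fun B => Algebra.adjoin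 k {y : K | IsIntegral ↥B y}; let tower : Subalgebra k K → ℕ → Subalgebra k K := fun A m => @Nat.rec (fun _ => Subalgebra k K) (loc A) (fun _ B => loc (nrm (chart B))) m; IsRegularLocalRing ↥(tower A 1)

-- `CurveStep` holds: proved by `Summit.ResolutionOfSingularities.ResolutionOfSingularities.Theorems.curveStep_proof` (its module imports this route file, so no `_holds` link can be stated here).

/-- item stmt-ResolutionOfSingularities-16488 · support · rank 9 · open · by planner
sources: Lipman1978, Spivakovsky1990, IyengarTakahashi2014, Esentepe2018
[support] dominated special case (the card's K1, first real test): for A of Krull dimension 2 the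
canonical tower terminates along every valuation — normalised blow-ups of the m-primary ideal ca of
a normal surface singularity in place of Zariski–Lipman's maximal ideal; checked by hand on A_n (ca
= (x,y,z^⌈n/2⌉) bisects the chain), D_4, D_5 (card computations), open at non-rational and wild
rational double points. [difficulty: L] -/
@[route_item "route-ResolutionOfSingularities-HomologicalConductor", crux]
def SurfaceTermination : Prop :=
  ∀ p : ℕ, p.Prime → ∀ (k K : Type) [Field k] [CharP k p] [Field K] [Algebra k K] (O : ValuationSubring K) (A : Subalgebra k K), (∀ c : k, algebraMap k K c ∈ O) → A.FG → IsFractionRing ↥A K → A.toSubring ≤ O.toSubring → ringKrullDim ↥A = 2 → let ca : Subalgebra k K → Set K := fun A => {x : K | ∃ hx : x ∈ A, ∃ n : ℕ, ∀ i : ℕ, n ≤ i → ∀ (M N : ModuleCat.{0} ↥A), Module.Finite ↥A M → Module.Finite ↥A N → ∀ e : CategoryTheory.Abelian.Ext.{0} M N i, (⟨x, hx⟩ : ↥A) • e = 0}; let loc : Subalgebra k K → Subalgebra k K := fun A => Algebra.adjoin k {y : K | ∃ a ∈ A, ∃ s ∈ A, s⁻¹ ∈ O ∧ y = a * s⁻¹};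 let chart : Subalgebra k K → Subalgebra k K := fun A => Algebra.adjoin k ((A : Set K) ∪ {y : K | ∃ c ∈ ca A, ∃ x ∈ ca A, x ≠ 0 ∧ (∀ c' ∈ ca A, c' * x⁻¹ ∈ O) ∧ y = c * x⁻¹}); let nrm : Subalgebra k K → Subalgebra k K := fun B => Algebra.adjoin k {y : K | IsIntegral ↥B y}; let tower : Subalgebra k K → ℕ → Subalgebra k K := fun A m => @Nat.rec (fun _ => Subalgebra k K) (loc A) (fun _ B => loc (nrm (chart B))) m; ∃ m : ℕ, IsRegularLocalRing ↥(tower A m)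

/-- item stmt-ResolutionOfSingularities-19920 · support · rank 9 · closed · proved by Summit.ResolutionOfSingularities.ResolutionOfSingularities.Theorems.persistenceRadical_proof (prover) · by planner
[support] rung S-3 of crux Persistence (stmt-ResolutionOfSingularities-16484), chain W4.4b: RADICAL
persistence of the cohomology annihilator along the canonical tower — every x ∈ ca(T_m) has a power
x^N (N ≥ 1) in ca(T_(m+1)); the crux VERBATIM with exponent N instead of exponent one (route binders
and inline lets identical). PROVED in the tree MODULO the named fact singEqVCa_essFiniteType
(Iyengar–Takahashi 2016 Thm 5.4, being discharged in-tree by chain W4.4: h36 p464623, h52 p462167,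
h_desc in progress): Theorems/HomologicalConductorPersistenceRadicalTower.lean
`PersistenceRadical.persistenceRadical_route` (res-L1-w44b-stub-3, p465428; binder match certified
by planner sketch RadicalReglueSketch.lean `persistenceRadical_of_singEqVCa`, rc 0). Mechanism
(OURS): Sing(nrm B[ca B/x]) ⊆ V(x) (regularOffCentre p463221) + V(ca) = Sing upstairs ⇒ x ∈ √ca.
Role: the candidate replacement of exponent-one Persistence in the deciding theorem (W2: no landed
NoZeno stub consumes exponent one; NoZenoR := NoZeno with this hypothesis; closes_radical certified
in the same sketch) — adoption is a route edit for priority8/tenure, not executed by the chain. Why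
it might fail: it does not modulo Thm -/
@[route_item "route-ResolutionOfSingularities-HomologicalConductor", crux]
def PersistenceRadical : Prop :=
  ∀ p : ℕ, p.Prime → ∀ (k K : Type) [Field k] [CharP k p] [Field K] [Algebra k K] (O : ValuationSubring K) (A : Subalgebra k K), (∀ c : k, algebraMap k K c ∈ O) → A.FG → IsFractionRing ↥A K → A.toSubring ≤ O.toSubring → let ca : Subalgebra k K → Set K := fun A => {x : K | ∃ hx : x ∈ A, ∃ n : ℕ, ∀ i : ℕ, n ≤ i → ∀ (M N : ModuleCat.{0} ↥A), Module.Finite ↥A M → Module.Finite ↥A N → ∀ e : CategoryTheory.Abelian.Ext.{0} M N i, (⟨x, hx⟩ : ↥A) • e = 0}; let loc : Subalgebra k K → Subalgebra k K := fun A => Algebra.adjoin k {y : K | ∃ a ∈ A, ∃ s ∈ A, s⁻¹ ∈ O ∧ y = a * s⁻¹}; let chart : Subalgebra k K → Subalgebra k K := fun A => Algebra.adjoin k ((A : Set K) ∪ {y : K | ∃ c ∈ ca A, ∃ x ∈ ca A, x ≠ 0 ∧ (∀ c' ∈ ca A, c' * x⁻¹ ∈ O) ∧ y = c * x⁻¹});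 let nrm : Subalgebra k K → Subalgebra k K := fun B => Algebra.adjoin k {y : K | IsIntegral ↥B y}; let tower : Subalgebra k K → ℕ → Subalgebra k K := fun A m => @Nat.rec (fun _ => Subalgebra k K) (loc A) (fun _ B => loc (nrm (chart B))) m; ∀ m : ℕ, ∀ x ∈ ca (tower A m), ∃ N : ℕ, 1 ≤ N ∧ x ^ N ∈ ca (tower A (m + 1))

-- `PersistenceRadical` holds: proved by `Summit.ResolutionOfSingularities.ResolutionOfSingularities.Theorems.persistenceRadical_proof` (its module imports this route file, so no `_holds` link can be stated here).

/-- item stmt-ResolutionOfSingularities-19970 · support · rank 9 · open · by planner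
[support · OURS · L1 w44b] rung S-2 of crux Persistence (stmt-ResolutionOfSingularities-16484),
chain W4.4b: the crux VERBATIM under the extra hypothesis ringKrullDim ↥A ≤ 2 (surfaces; binder
placed exactly as in PersistenceDimOne stmt-20102, which it contains and which is proved, p472388).
Everything that survived the W4.4b card triage (res-L1-w44b-tri-1 TRIAGE v1 §6–8, res-L1-w44b-tri-2
TRIAGE v2, 2026-08-27) is dimension two, so this is the statement the surviving lines actually
attack: line supply (exceptional-subdivisor / sandwich generation = FGeneration at the points of the
normalised ca-chart; toric case = one-sided continuant inequality on Z_ca-contracted chains, 0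
failures over all cyclic quotient towers d ≤ 300, jobs j261409 / repro j263249), line std
(hull–dual–syzygy transfer, ⊆ Lines/std of the crux), line complete (complete-annihilator Rees
inequalities at RATIONAL points only; the non-rational typed form is refuted at the quartic cone
x^4+y^3z−yz^3, xz^2 ∈ ca‾∖ca, tri-1 §6). Why it might fail: a singular NON-RATIONAL point of the
normalised ca-chart with small ca upstairs — first specimen the chart U_x(E_12) = k[z,p,q,r]/(pq+r^2
z+z^2, pr−q^2) of the minimally ellip -/
@[route_item "route-ResolutionOfSingularities-HomologicalConductor"]
def PersistenceSurface : Prop :=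
  ∀ p : ℕ, p.Prime → ∀ (k K : Type) [Field k] [CharP k p] [Field K] [Algebra k K] (O : ValuationSubring K) (A : Subalgebra k K), (∀ c : k, algebraMap k K c ∈ O) → A.FG → IsFractionRing ↥A K → A.toSubring ≤ O.toSubring → ringKrullDim ↥A ≤ 2 → let ca : Subalgebra k K → Set K := fun A => {x : K | ∃ hx : x ∈ A, ∃ n : ℕ, ∀ i : ℕ, n ≤ i → ∀ (M N : ModuleCat.{0} ↥A), Module.Finite ↥A M → Module.Finite ↥A N → ∀ e : CategoryTheory.Abelian.Ext.{0} M N i, (⟨x, hx⟩ : ↥A) • e = 0}; let loc : Subalgebra k K → Subalgebra k K := fun A => Algebra.adjoin k {y : K | ∃ a ∈ A, ∃ s ∈ A, s⁻¹ ∈ O ∧ y = a * s⁻¹}; let chart : Subalgebra k K → Subalgebra k K := fun A => Algebra.adjoin k ((A : Set K) ∪ {y : K | ∃ c ∈ ca A, ∃ x ∈ ca A, x ≠ 0 ∧ (∀ c' ∈ ca A, c' * x⁻¹ ∈ O) ∧ y = c * x⁻¹}); let nrm : Subalgebra k K → Subalgebra k K := fun B => Algebra.adjoin k {y : K | IsIntegral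 ↥B y}; let tower : Subalgebra k K → ℕ → Subalgebra k K := fun A m => @Nat.rec (fun _ => Subalgebra k K) (loc A) (fun _ B => loc (nrm (chart B))) m; ∀ m : ℕ, ca (tower A m) ⊆ ca (tower A (m + 1))

/-- item stmt-ResolutionOfSingularities-20102 · support · rank 9 · closed · proved by Summit.ResolutionOfSingularities.ResolutionOfSingularities.Theorems.persistenceDimOne_proof (prover) · by planner
[support] rung S-1 of crux Persistence (stmt-ResolutionOfSingularities-16484), chain W4.4b: the crux
VERBATIM under the extra hypothesis ringKrullDim ↥A ≤ 1 (curves: every stage T_(m+1) of the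
canonical ca-tower is a regular local ring, so ca(T_(m+1)) = T_(m+1) ⊇ T_m ⊇ ca(T_m)). PROVED in the
tree: Theorems/HomologicalConductorPersistenceDimOne.lean
`PersistenceDimOne.persistence_of_ringKrullDim_le_one` (res-L1-w44b-stub-2, p461490; instrument by
res-L1-w44b-tri-2 DimOne.lean). Why it might fail: it does not (landed); filed so the rung is an
item of record. Sources: IyengarTakahashi2014 Def 2.1, Ex 2.5; OURS. -/
@[route_item "route-ResolutionOfSingularities-HomologicalConductor"]
def PersistenceDimOne : Prop :=
  ∀ p : ℕ, p.Prime → ∀ (k K : Type) [Field k] [CharP k p] [Field K] [Algebra k K] (O : ValuationSubring K) (A : Subalgebra k K), (∀ c : k, algebraMap k K c ∈ O) → A.FG → IsFractionRing ↥A K → A.toSubring ≤ O.toSubring → ringKrullDim ↥A ≤ 1 → let ca : Subalgebra k K → Set K := fun A => {x : K | ∃ hx : x ∈ A, ∃ n : ℕ, ∀ i : ℕ, n ≤ i → ∀ (M N : ModuleCat.{0} ↥A), Module.Finite ↥A M → Module.Finite ↥A N → ∀ e : CategoryTheory.Abelian.Ext.{0} M N i, (⟨x, hx⟩ : ↥A)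 • e = 0}; let loc : Subalgebra k K → Subalgebra k K := fun A => Algebra.adjoin k {y : K | ∃ a ∈ A, ∃ s ∈ A, s⁻¹ ∈ O ∧ y = a * s⁻¹}; let chart : Subalgebra k K → Subalgebra k K := fun A => Algebra.adjoin k ((A : Set K) ∪ {y : K | ∃ c ∈ ca A, ∃ x ∈ ca A, x ≠ 0 ∧ (∀ c' ∈ ca A, c' * x⁻¹ ∈ O) ∧ y = c * x⁻¹}); let nrm : Subalgebra k K → Subalgebra k K := fun B => Algebra.adjoin k {y : K | IsIntegral ↥B y}; let tower : Subalgebra k K → ℕ → Subalgebra k K := fun A m => @Nat.rec (fun _ => Subalgebra k K) (loc A) (fun _ B => loc (nrm (chart B))) m; ∀ m : ℕ, ca (tower A m) ⊆ ca (tower A (m + 1))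

-- `PersistenceDimOne` holds: proved by `Summit.ResolutionOfSingularities.ResolutionOfSingularities.Theorems.persistenceDimOne_proof` (its module imports this route file, so no `_holds` link can be stated here).

-- earlier Assembly (stmt-ResolutionOfSingularities-16489, replaced 2026-08-27T16:15:41Z -> stmt-ResolutionOfSingularities-20726): retired by None — Persistence → StrictDrop → NoZeno → Globalisation → _root_.ResolutionOfSingularities
/-- item stmt-ResolutionOfSingularities-20726 · assembly · rank 1 · open · by planner
sources: IyengarTakahashi2014, ZariskiSamuel1960
[assembly] Persistence → StrictDrop → NoZeno → Globalisation → ResolutionOfSingularities. -/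
@[route_item "route-ResolutionOfSingularities-HomologicalConductor"]
def Assembly : Prop :=
  PersistenceRadical → StrictDrop → NoZenoR → Globalisation → _root_.ResolutionOfSingularities

-- records of items no longer active in this route (dropped / restated):
-- earlier Persistence (stmt-ResolutionOfSingularities-16484, dropped 2026-08-27T16:15:41Z): refuted by Summit.ResolutionOfSingularities.ResolutionOfSingularities.Theorems.not_Persistence — ∀ p : ℕ, p.Prime → ∀ (k K : Type) [Field k] [CharP k p] [Field K] [Algebra k K] (O : ValuationSubring K) (A : Subalgebra k K), (∀ c : k, algebraMap k K c ∈ O) → A.FG → IsFractionRing ↥A K → A.toSubring ≤ O.toSubri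

/-! D-0027 §2.1 — DECIDING THEOREM (planner-authored via `route open/edit --closes-file`; by operator:999:1589267 2026-08-26T22:16:55Z):
its hypotheses are this route's items and its conclusion the sub-problem Statement (glue_lint), and it elaborates with this file. -/

@[closes "route-ResolutionOfSingularities-HomologicalConductor"] theorem closes (hPR : PersistenceRadical) (hD : StrictDrop) (hT : NoZenoR) (hG : Globalisation) :
    _root_.ResolutionOfSingularities :=
  fun p hp => hG p hp (hT hPR hD p hp)

end Summit.ResolutionOfSingularities.ResolutionOfSingularities.Theses.HomologicalConductor
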